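import Mathlib
import Summits.ValiantsHypothesis.ValiantsHypothesis.Theses.LacunarySymmetroid
import Summits.ValiantsHypothesis.ValiantsHypothesis.Theorems.LacunarySymmetroidMatrixDescartesCensusRealExponentsThreeByThree
import Summits.ValiantsHypothesis.ValiantsHypothesis.Theorems.LacunarySymmetroidMatrixDescartesCensusConfluentClosure

/-!
# `MatrixDescartes` census — the CONFLUENT CLOSURE of door A at `(3,4)`: a log-letter nineteen refutes `DoorA34`

HONEST FRAMING.  Object-search cell `pub-symmetroid`, door-A companion item `Theses.LacunarySymmetroid.DoorA34 = PosRootLawAt 3 4 18`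
(stmt-ValiantsHypothesis-19980; OPEN, typed, never asserted).  This file proves ONE elementary implication and decides
nothing: `DoorA34` stays OPEN, no register moves, nothing bears on `MatrixDescartes` (stmt-ValiantsHypothesis-18050) or
on `VP ≠ VNP`.  It is the `3 × 3`, four-term twin of `…CensusConfluentClosure` (door `(2,6)`).

The natural limit object of a real symmetric `(3,4)` pencil along a face `d_i = d_j` of the exponent simplex is a
CONFLUENT pencil with one LOG-LETTER pair, `F₀(t) = S₀ + e^{a t}(A + t·B) + e^{c t} S₂` in the variable `t = log x`
(determinant in a 20-function exponential-polynomial system, Descartes/Laguerre ceiling 19, as for the door).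

* `approx_sum_eq` (with `approxLetters_isSymm`) — the honest four-term real-exponent pencils with exponents `(0, a, a + η, c)`
  and letters `(S₀, A − η⁻¹B, η⁻¹B, S₂)` equal `S₀ + e^{a t}(A + ((e^{η t} − 1)/η)·B) + e^{c t} S₂`;
* `tendsto_det_approx` — their determinants converge (difference quotient `Confluent.tendsto_expSlope` of the `(2,6)` file) to `det F₀(t)` as `η → 0⁺` (pointwise in `t`);
* **`not_posRootLawAt_3_4_18_of_confluent_brackets`** — if `det F₀` changes sign across nineteen pairwise disjoint increasing
  brackets, then `¬ PosRootLawAt 3 4 18` (tree: `Census.RealExp.le_ncard_of_brackets`, `ncard_rpow_eq_ncard_exp`,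
  `not_posRootLawAt_three_iff`);
* `not_doorA34_of_confluent_brackets` — the same conclusion as `¬ Theses.LacunarySymmetroid.DoorA34`.

So a refuter who exhibits ONE confluent `(3,4)` pencil with 20 certified alternating signs closes door `(3,4)` negatively; no
such pencil is claimed to exist.

[folklore] Elementary: a difference quotient converging to a derivative, continuity of `det`, the intermediate value theorem
and the tree's real-exponent transfer.
-/

-- `Summit.ValiantsHypothesis.ValiantsHypothesis.…` repeats a component by the D-0017 layout
-- (single-conjunct summit), which the `dupNamespace` linter flags; the name is mandated.
set_option linter.dupNamespace false

namespace Summit.ValiantsHypothesis.ValiantsHypothesis.Theorems.LacunarySymmetroidMatrixDescartes.Census.RealExp.ConfluentThreeFour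

open Filter Topology
open scoped BigOperators Matrix
open Summit.ValiantsHypothesis.ValiantsHypothesis.Theorems.MatrixDescartes.Negative (PosRootLawAt)
open Summit.ValiantsHypothesis.ValiantsHypothesis.Theorems.LacunarySymmetroidMatrixDescartes.Census.RealExp
  (le_ncard_of_brackets ncard_rpow_eq_ncard_exp not_posRootLawAt_three_iff)
open Summit.ValiantsHypothesis.ValiantsHypothesis.Theorems.LacunarySymmetroidMatrixDescartes.Census.RealExp.Confluent
  (tendsto_expSlope)

/-- The approximants' letters are symmetric when the data are. [folklore] -/
theorem approxLetters_isSymm {S₀ A B S₂ : Matrix (Fin 3) (Fin 3) ℝ} (h₀ : S₀.IsSymm) (hA : A.IsSymm)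
    (hB : B.IsSymm) (h₂ : S₂.IsSymm) (η : ℝ) (l : Fin 4) :
    (((![S₀, A - η⁻¹ • B, η⁻¹ • B, S₂] : Fin 4 → Matrix (Fin 3) (Fin 3) ℝ) l)).IsSymm := by
  fin_cases l
  · simpa using h₀
  · simpa using hA.sub (hB.smul _)
  · simpa using hB.smul _
  · simpa using h₂

/-- **The approximants are honest six-term pencils converging to the confluent one**: for `η ≠ 0`,
`∑_l e^{δ_l t} S'_l = S₀ + e^{a t}(A + ((e^{η t} − 1)/η)·B) + e^{c t} S₂`. [folklore] -/
theorem approx_sum_eq (a c : ℝ) (S₀ A B S₂ : Matrix (Fin 3) (Fin 3) ℝ) {η : ℝ} (hη : η ≠ 0) (t : ℝ) :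
    ∑ l, Real.exp (((![0, a, a + η, c] : Fin 4 → ℝ) l) * t) • ((![S₀, A - η⁻¹ • B, η⁻¹ • B, S₂] : Fin 4 → Matrix (Fin 3) (Fin 3) ℝ) l) =
      S₀ + Real.exp (a * t) • (A + ((Real.exp (η * t) - 1) / η) • B) + Real.exp (c * t) • S₂ := by
  ext i j
  simp [Fin.sum_univ_four, Matrix.sum_apply, Matrix.add_apply, Matrix.smul_apply,
    Matrix.sub_apply, Real.exp_add, add_mul]
  field_simp
  ring

/-- **Pointwise convergence of the approximants' determinants to the confluent determinant** (`η → 0⁺`). [folklore] -/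
theorem tendsto_det_approx (a c : ℝ) (S₀ A B S₂ : Matrix (Fin 3) (Fin 3) ℝ) (t : ℝ) :
    Tendsto (fun η : ℝ => (∑ l, Real.exp (((![0, a, a + η, c] : Fin 4 → ℝ) l) * t) • ((![S₀, A - η⁻¹ • B, η⁻¹ • B, S₂] : Fin 4 → Matrix (Fin 3) (Fin 3) ℝ) l)).det)
      (𝓝[>] 0) (𝓝 (S₀ + Real.exp (a * t) • (A + t • B) + Real.exp (c * t) • S₂).det) := by
  have hM : Tendsto (fun η : ℝ => S₀ + Real.exp (a * t) • (A + ((Real.exp (η * t) - 1) / η) • B) +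
        Real.exp (c * t) • S₂)
      (𝓝[>] 0) (𝓝 (S₀ + Real.exp (a * t) • (A + t • B) + Real.exp (c * t) • S₂)) := by
    refine (tendsto_const_nhds.add ?_).add tendsto_const_nhds
    exact (tendsto_const_nhds.add ((tendsto_expSlope t).smul_const B)).const_smul _
  have hdet := ((continuous_id.matrix_det).tendsto _).comp hM
  refine hdet.congr' ?_
  filter_upwards [self_mem_nhdsWithin] with η hη
  simp only [Function.comp, id]
  rw [approx_sum_eq a c S₀ A B S₂ (ne_of_gt hη) t]

/-- **A confluent nineteen refutes the (3,4) law**: if the determinant of a confluent `3 × 3` four-term pencil with symmetric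
letters changes sign across nineteen pairwise disjoint increasing brackets `u i < v i` (in `t = log x`), then
`¬ PosRootLawAt 3 4 18` — for small `η > 0` the honest pencil on exponents `(0, a, a + η, c)` inherits the brackets, has
`≥ 19` zeros, and the tree's real-exponent transfer (`not_posRootLawAt_three_iff`) produces an integer support. [folklore] -/
theorem not_posRootLawAt_3_4_18_of_confluent_brackets (a c : ℝ) {S₀ A B S₂ : Matrix (Fin 3) (Fin 3) ℝ}
    (h₀ : S₀.IsSymm) (hA : A.IsSymm) (hB : B.IsSymm) (h₂ : S₂.IsSymm)
    (u v : Fin 19 → ℝ) (huv : ∀ i, u i < v i) (hdisj : ∀ i j, i < j → v i < u j)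
    (hsign : ∀ i, ((S₀ + Real.exp (a * (u i)) • (A + (u i) • B) + Real.exp (c * (u i)) • S₂)).det *
      ((S₀ + Real.exp (a * (v i)) • (A + (v i) • B) + Real.exp (c * (v i)) • S₂)).det < 0) :
    ¬ PosRootLawAt 3 4 18 := by
  -- eventually (η → 0⁺) every bracket is inherited by the honest approximant
  have hev : ∀ᶠ η in 𝓝[>] (0 : ℝ), 0 < η ∧ ∀ i,
      (∑ l, Real.exp (((![0, a, a + η, c] : Fin 4 → ℝ) l) * u i) • ((![S₀, A - η⁻¹ • B, η⁻¹ • B, S₂] : Fin 4 → Matrix (Fin 3) (Fin 3) ℝ) l)).det *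
        (∑ l, Real.exp (((![0, a, a + η, c] : Fin 4 → ℝ) l) * v i) • ((![S₀, A - η⁻¹ • B, η⁻¹ • B, S₂] : Fin 4 → Matrix (Fin 3) (Fin 3) ℝ) l)).det < 0 := by
    refine (self_mem_nhdsWithin : Set.Ioi (0 : ℝ) ∈ 𝓝[>] (0 : ℝ)) |> fun hpos => ?_
    have hall : ∀ᶠ η in 𝓝[>] (0 : ℝ), ∀ i,
        (∑ l, Real.exp (((![0, a, a + η, c] : Fin 4 → ℝ) l) * u i) • ((![S₀, A - η⁻¹ • B, η⁻¹ • B, S₂] : Fin 4 → Matrix (Fin 3) (Fin 3) ℝ) l)).det *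
          (∑ l, Real.exp (((![0, a, a + η, c] : Fin 4 → ℝ) l) * v i) • ((![S₀, A - η⁻¹ • B, η⁻¹ • B, S₂] : Fin 4 → Matrix (Fin 3) (Fin 3) ℝ) l)).det < 0 := by
      refine eventually_all.2 fun i => ?_
      have hprod := (tendsto_det_approx a c S₀ A B S₂ (u i)).mul
        (tendsto_det_approx a c S₀ A B S₂ (v i))
      exact hprod.eventually (Iio_mem_nhds (hsign i))
    filter_upwards [hpos, hall] with η hη h using ⟨hη, h⟩
  obtain ⟨η, hηpos, hη⟩ := hev.exists
  set δ' : Fin 4 → ℝ := (![0, a, a + η, c] : Fin 4 → ℝ) with hδ'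
  set S' : Fin 4 → Matrix (Fin 3) (Fin 3) ℝ := (![S₀, A - η⁻¹ • B, η⁻¹ • B, S₂] : Fin 4 → Matrix (Fin 3) (Fin 3) ℝ) with hS'
  have hcount := (le_ncard_of_brackets δ' S' (by norm_num : 0 < 19) huv hdisj hη).2
  rw [← ncard_rpow_eq_ncard_exp δ' S'] at hcount
  exact (not_posRootLawAt_three_iff 4 18).mpr ⟨δ', S', approxLetters_isSymm h₀ hA hB h₂ η, hcount⟩

/-- **Confluent closure of door A at `(3,4)`**: nineteen sign-change brackets of a confluent (log-letter) `(3,4)` pencil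
determinant refute `Theses.LacunarySymmetroid.DoorA34` itself (`DoorA34` is `PosRootLawAt 3 4 18` verbatim). No such
pencil is claimed to exist; the door stays OPEN. [folklore] -/
theorem not_doorA34_of_confluent_brackets (a c : ℝ) {S₀ A B S₂ : Matrix (Fin 3) (Fin 3) ℝ}
    (h₀ : S₀.IsSymm) (hA : A.IsSymm) (hB : B.IsSymm) (h₂ : S₂.IsSymm)
    (u v : Fin 19 → ℝ) (huv : ∀ i, u i < v i) (hdisj : ∀ i j, i < j → v i < u j)
    (hsign : ∀ i, ((S₀ + Real.exp (a * (u i)) • (A + (u i) • B) + Real.exp (c * (u i)) • S₂)).det *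
      ((S₀ + Real.exp (a * (v i)) • (A + (v i) • B) + Real.exp (c * (v i)) • S₂)).det < 0) :
    ¬ Summit.ValiantsHypothesis.ValiantsHypothesis.Theses.LacunarySymmetroid.DoorA34 := by
  intro hD
  have h := not_posRootLawAt_3_4_18_of_confluent_brackets a c h₀ hA hB h₂ u v huv hdisj hsign
  exact h fun d S hS => hD d S hS

end Summit.ValiantsHypothesis.ValiantsHypothesis.Theorems.LacunarySymmetroidMatrixDescartes.Census.RealExp.ConfluentThreeFour
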